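import Summits.QuantumFields.YangMills.Theorems.AllWindowsColdBoxTorusGreenGradientDecay
import Summits.QuantumFields.YangMills.Theorems.AllWindowsColdBoxTorusGreenSupplement

/-!
# The gradient of the torus Green function at all points (supplement for the image formula; LINE-18 K1 / LINE-19–20 U1, (J′1))

The tree bound `TorusGreenGradient.torusGreen_grad_mul_dist_pow_three_le` (`|G̃_L(z+eᵢ) − G̃_L(z)|·dist(0,z)³ ≤ C` for `z ≠ 0`, `d = 4`) extended to
ALL points: `torusGreen_grad_le` — `|G̃_L(z+eᵢ) − G̃_L(z)|·max(1, dist(0,z))³ ≤ C` for `L ≥ 1`; at `z = 0` the difference is `G̃(eᵢ) − G̃(0) ∈ [−1, 0]`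
(`0 ≤ 2G̃(0) − G̃(eᵢ) − G̃(−eᵢ) ≤ 2` from `torusGreen_laplacian`, and `G̃(−eᵢ) = G̃(eᵢ)` by `torusGreen_reflect`).  No definitions; standard axioms.

HONEST LABEL: helper lemma toward the OPEN kernel stubs K1 (⟨stmt-QuantumFields-24006⟩) / S3b–U1 (⟨24004⟩, ⟨24336⟩); no stub, crux, rung or summit is
proved here; the Yang–Mills mass gap is NOT proved by this file.
-/

set_option autoImplicit false

noncomputable section

open Finset ZMod
open scoped Real BigOperators

namespace Summit.QuantumFields.YangMills.Theorems.AllWindowsColdBox.BoxKernel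

open Literature.Probability.LatticeModels
open Summit.QuantumFields.YangMills.Theorems.AllWindowsColdBox.TorusGreenGradient (torusGreen_grad_mul_dist_pow_three_le)

variable {d L : ℕ} [NeZero L]

/-- `G̃(−e_ν) = G̃(e_ν)`. -/
theorem torusGreen_neg_single (ν : Fin d) : torusGreen (-(Pi.single ν 1 : TorusSite d L)) = torusGreen (Pi.single ν 1 : TorusSite d L) := by
  have : Function.update (-(Pi.single ν 1 : TorusSite d L)) ν (-((-(Pi.single ν 1 : TorusSite d L)) ν)) = (Pi.single ν 1 : TorusSite d L) := by
    funext κ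
    by_cases hκ : κ = ν
    · subst hκ; simp
    · simp [Function.update_of_ne hκ, Pi.single_eq_of_ne hκ]
  rw [← torusGreen_reflect (-(Pi.single ν 1 : TorusSite d L)) ν, this]

/-- At the origin the gradient of `G̃` is in `[−1, 0]`: `|G̃(e_ν) − G̃(0)| ≤ 1`. -/
theorem abs_torusGreen_single_sub_zero_le (ν : Fin d) :
    |torusGreen ((0 : TorusSite d L) + Pi.single ν 1) - torusGreen (0 : TorusSite d L)| ≤ 1 := by
  have h0 := torusGreen_second_difference_zero_nonneg (d := d) (L := L) ν
  have h2 := abs_torusGreen_second_difference_zero_le (d := d) (L := L) ν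
  rw [zero_sub, torusGreen_neg_single] at h0 h2
  simp only [zero_add] at h0 h2 ⊢
  rw [abs_le] at h2 ⊢
  constructor <;> linarith [h2.1, h2.2]

/-- **Uniform gradient bound for the torus Green function, all points** (`d = 4`): an absolute `C` with
`|G̃_L(z+eᵢ) − G̃_L(z)| · max(1, dist(0,z))³ ≤ C` for all `L ≥ 1`, `i`, `z`. -/
theorem torusGreen_grad_le : ∃ C : ℝ, 0 ≤ C ∧ ∀ (L : ℕ) [NeZero L] (i : Fin 4) (z : TorusSite 4 L),
    |torusGreen (z + Pi.single i 1) - torusGreen z| * (max 1 (Real.sqrt (∑ k, (((z k).valMinAbs : ℤ) : ℝ) ^ 2))) ^ 3 ≤ C := by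
  obtain ⟨C₀, hC₀⟩ := torusGreen_grad_mul_dist_pow_three_le
  have hC₀0 : 0 ≤ C₀ := by
    haveI : NeZero (2 : ℕ) := ⟨by norm_num⟩
    have hz : (Pi.single (0 : Fin 4) (1 : ZMod 2) : TorusSite 4 2) ≠ 0 := by
      intro h; have := congrFun h 0; simp at this
    exact le_trans (mul_nonneg (abs_nonneg _) (pow_nonneg (Real.sqrt_nonneg _) _)) (hC₀ 2 0 _ hz)
  refine ⟨max C₀ 1, le_max_of_le_right zero_le_one, ?_⟩
  intro L _ i z
  by_cases hz : z ≠ 0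
  · rw [max_eq_right (one_le_sqrt_sum_valMinAbs_sq hz)]
    exact (hC₀ L i z hz).trans (le_max_left _ _)
  · push Not at hz
    subst hz
    have hdist : Real.sqrt (∑ k, ((((0 : TorusSite 4 L) k).valMinAbs : ℤ) : ℝ) ^ 2) = 0 := by simp
    rw [hdist, max_eq_left zero_le_one, one_pow, mul_one]
    exact (abs_torusGreen_single_sub_zero_le i).trans (le_max_right _ _)

end Summit.QuantumFields.YangMills.Theorems.AllWindowsColdBox.BoxKernel

end
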